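import Summits.SmoothPoincare4.SmoothPoincare4.Theorems.EntropyRungBakryEmeryLogSobolevComplete
import Summits.SmoothPoincare4.SmoothPoincare4.Theses.EntropyRung
import Literature.Geometry.Riemannian.GradientShrinkerProofs
import Literature.Geometry.Riemannian.CutLocusProofs
import Literature.Geometry.Riemannian.RiemannianDistance
import Literature.AlgebraicTopology.FundamentalGroup.SphereSimplyConnected
import HarnessLib

/-!
# The log-Sobolev inequality of a closed gradient shrinker
(line `cgy-variance-pivot`, crux `EntropyRung.CompactShrinkerGap`, item stmt-SmoothPoincare4-10870;
registered helper `helper_shrinkerLogSobolev`)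

For a Riemannian metric `g` (Levi-Civita connection) on a closed connected manifold `M` modelled on `ℝⁿ`
and a smooth `f` with `Ric + Hess f = g/2` (a gradient shrinking soliton; no normalisation of `f` is
used), the probability measure `m = e^{-f} dV / Z`, `Z = ∫ e^{-f} dV`, is a `CD(½, ∞)` space, so the
Bakry–Émery logarithmic Sobolev inequality (route item `EntropyRung.BakryEmeryLogSobolev`, PROVED in
`EntropyRungBakryEmeryLogSobolevComplete.lean` as `BakryEmeryComplete.bakryEmeryLogSobolev_proof`) holds
with constant `(2K)⁻¹ = 1`. In the un-normalised form used by the line's dictionary this reads, for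
every smooth `h`,

  `∫ h e^{h−f} dV − (∫ e^{h−f} dV) · log (∫ e^{h−f} dV / ∫ e^{−f} dV) ≤ ∫ |∇h|² e^{h−f} dV`.

* `shrinkerLogSobolev_of_connectedSpace` — the inequality on a closed connected shrinker of any
  dimension `n`: apply the route item with `V = f + log Z` (`∫ e^{-V} = 1`, `Hess V = Hess f`,
  `hessian_add_const`), `K = ½` (the soliton equation, with equality), and
  `φ = h + log Z − log B`, `B = ∫ e^{h−f}` (`∫ e^{φ} e^{-V} = 1`, `|∇φ|² = |∇h|²`, `gradSq_add_const`);
  on a compact manifold the closed distance balls are compact (`continuous_edist`), every continuous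
  integrand is integrable (`integrable_of_continuous`) and the second moment is finite
  (`edist_ne_top` on a connected manifold); finally multiply through by `B > 0`.
* `helper_shrinkerLogSobolev` — the registered typing (dimension `4`, `M ≃ₕ S⁴`): `M` is simply
  connected (`simplyConnectedSpace_euclideanSphere`), hence connected.

References: D. Bakry, M. Émery, *Diffusions hypercontractives* (1985); J. A. Carrillo, L. Ni,
Comm. Anal. Geom. 17 (2009), Thm. 3.1 (p. 7); D. Bakry, I. Gentil, M. Ledoux, *Analysis and Geometry
of Markov Diffusion Operators* (2014), Prop. 5.7.1 (p. 268).
-/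

noncomputable section

-- the registered namespace `Summit.SmoothPoincare4.SmoothPoincare4.Theorems` repeats a component
set_option linter.dupNamespace false

open MeasureTheory Set Function Filter
open scoped Manifold ContDiff ENNReal Topology ContinuousMap

namespace Summit.SmoothPoincare4.SmoothPoincare4.Theorems

open Literature.Geometry Literature.Geometry.Lorentzian Literature.Geometry.Riemannian
  Literature.Geometry.Lorentzian.PseudoRiemannianMetric

section Connected

variable {n : ℕ} {M : Type} [TopologicalSpace M] [T2Space M] [SecondCountableTopology M]
  [ChartedSpace (EuclideanSpace ℝ (Fin n)) M] [IsManifold (𝓡 n) ∞ M] [CompactSpace M]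
  [ConnectedSpace M] [T3Space M] [MeasurableSpace M] [BorelSpace M]
  {g : PseudoRiemannianMetric (𝓡 n) ∞ (EuclideanSpace ℝ (Fin n)) (TangentSpace (𝓡 n) : M → Type _)}
  [g.HasLeviCivita]

/-- **The log-Sobolev inequality of a closed connected gradient shrinker** (un-normalised form): for
`g` Riemannian (Levi-Civita) on a closed connected `M` modelled on `ℝⁿ`, `f` smooth with
`Ric + Hess f = g/2`, and every smooth `h`,
`∫ h e^{h−f} − (∫ e^{h−f}) log (∫ e^{h−f} / ∫ e^{−f}) ≤ ∫ |∇h|² e^{h−f}` — the Bakry–Émery inequality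
`Ent_m(ρ) ≤ ∫ |∇ log ρ|² ρ dm` of the `CD(½, ∞)` probability space `m = e^{-f} dV / ∫ e^{-f}` at
`ρ = e^{h} / ∫ e^{h} dm` (route item `BakryEmeryLogSobolev` with `V = f + log ∫e^{-f}`, `K = ½`,
`φ = h + log ∫e^{-f} − log ∫e^{h−f}`), multiplied through by `∫ e^{h−f} > 0`.
[cite: CarrilloNi2009, Thm. 3.1 (p. 7)] [cite: BakryGentilLedoux2014, Prop. 5.7.1 (p. 268)]
[cite: BakryEmery1985] -/
theorem shrinkerLogSobolev_of_connectedSpace (hg : g.IsRiemannian) {f : M → ℝ}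
    (hf : ContMDiff (𝓡 n) 𝓘(ℝ, ℝ) ∞ f)
    (hsol : ∀ (x : M) (X Y : TangentSpace (𝓡 n) x),
      g.ricci x X Y + g.hessian f x X Y = (1 / 2 : ℝ) * g.val x X Y)
    {h : M → ℝ} (hh : ContMDiff (𝓡 n) 𝓘(ℝ, ℝ) ∞ h) :
    ∫ x, h x * Real.exp (h x - f x) ∂(riemannianMeasure (g.toContMDiffRiemannianMetric hg)) -
        (∫ x, Real.exp (h x - f x) ∂(riemannianMeasure (g.toContMDiffRiemannianMetric hg))) *
          Real.log ((∫ x, Real.exp (h x - f x)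
              ∂(riemannianMeasure (g.toContMDiffRiemannianMetric hg))) /
            (∫ x, Real.exp (-f x) ∂(riemannianMeasure (g.toContMDiffRiemannianMetric hg)))) ≤
      ∫ x, g.gradSq h x * Real.exp (h x - f x)
        ∂(riemannianMeasure (g.toContMDiffRiemannianMetric hg)) := by
  -- the measure: finite (compactness) and non-zero (`M ≠ ∅`)
  set μ : Measure M := riemannianMeasure (g.toContMDiffRiemannianMetric hg) with hμ
  have hV' : g.riemVolume = μ := PseudoRiemannianMetric.riemVolume_eq hg
  have hInt : ∀ {F : M → ℝ}, Continuous F → Integrable F μ := fun hF ↦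
    hV' ▸ g.integrable_of_continuous hF
  haveI : Nonempty M := ConnectedSpace.toNonempty
  haveI : NeZero μ := ⟨fun h0 ↦ by
    have hpos := PseudoRiemannianMetric.riemVolume_univ_pos (I := 𝓡 n) (M := M) hg
    rw [hV', h0] at hpos
    simp at hpos⟩
  -- continuity of the integrands
  have hef : Continuous fun x ↦ Real.exp (-f x) := Real.continuous_exp.comp hf.continuous.neg
  have hehf : Continuous fun x ↦ Real.exp (h x - f x) :=
    Real.continuous_exp.comp (hh.continuous.sub hf.continuous)
  have hgradc : Continuous (g.gradSq h) := (contMDiff_gradSq g hh).continuous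
  -- the four integrals
  set Z : ℝ := ∫ x, Real.exp (-f x) ∂μ with hZ
  set B : ℝ := ∫ x, Real.exp (h x - f x) ∂μ with hB
  set A : ℝ := ∫ x, h x * Real.exp (h x - f x) ∂μ with hA
  set G : ℝ := ∫ x, g.gradSq h x * Real.exp (h x - f x) ∂μ with hG
  have hZpos : 0 < Z := integral_exp_pos (hInt hef)
  have hBpos : 0 < B := integral_exp_pos (hInt hehf)
  have hBne : B ≠ 0 := hBpos.ne'
  -- the probability potential `V = f + log Z` and the test function `φ = h + (log Z − log B)`
  set c : ℝ := Real.log Z - Real.log B with hc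
  set V : M → ℝ := fun x ↦ f x + Real.log Z with hV
  set φ : M → ℝ := fun x ↦ h x + c with hφ
  have hVs : ContMDiff (𝓡 n) 𝓘(ℝ, ℝ) ∞ V := hf.add contMDiff_const
  have hφs : ContMDiff (𝓡 n) 𝓘(ℝ, ℝ) ∞ φ := hh.add contMDiff_const
  have heV : ∀ x, Real.exp (-V x) = Real.exp (-f x) * Z⁻¹ := fun x ↦ by
    simp only [hV]
    rw [neg_add, Real.exp_add, Real.exp_neg (Real.log Z), Real.exp_log hZpos]
  have hφV : ∀ x, Real.exp (φ x) * Real.exp (-V x) = B⁻¹ * Real.exp (h x - f x) := fun x ↦ by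
    have h1 : φ x + -V x = -Real.log B + (h x - f x) := by
      simp only [hφ, hV, hc]
      ring
    rw [← Real.exp_add, h1, Real.exp_add, Real.exp_neg, Real.exp_log hBpos]
  have hgradφ : ∀ x, g.gradSq φ x = g.gradSq h x := fun x ↦
    g.gradSq_add_const c (hh.mdifferentiableAt (by norm_num))
  -- the hypotheses of the Bakry–Émery inequality on the closed manifold
  have hcpl : ∀ (x : M) (r : NNReal), IsCompact {y : M | g.edist hg x y ≤ r} := fun x r ↦
    (isClosed_le ((PseudoRiemannianMetric.continuous_edist hg).comp (Continuous.prodMk_right x))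
      continuous_const).isCompact
  have hRic : ∀ (x : M) (X : TangentSpace (𝓡 n) x),
      (1 / 2 : ℝ) * g.val x X X ≤ g.ricci x X X + g.hessian V x X X := by
    intro x X
    have hfx : ContMDiffAt (𝓡 n) 𝓘(ℝ, ℝ) 2 f x :=
      (hf.of_le (WithTop.coe_le_coe.mpr le_top)).contMDiffAt
    rw [show g.hessian V x X X = g.hessian f x X X from g.hessian_add_const (Real.log Z) hfx X X]
    exact le_of_eq (hsol x X X).symm
  have hmass : ∫ x, Real.exp (-V x) ∂μ = 1 := by
    simp_rw [heV]
    rw [integral_mul_const, ← hZ]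
    exact mul_inv_cancel₀ hZpos.ne'
  have hφmass : ∫ x, Real.exp (φ x) * Real.exp (-V x) ∂μ = 1 := by
    simp_rw [hφV]
    rw [integral_const_mul, ← hB]
    exact inv_mul_cancel₀ hBne
  have hdist : ∀ o : M, Continuous fun x ↦ (g.edist hg o x).toReal := fun o ↦
    ENNReal.continuousOn_toReal.comp_continuous
      ((PseudoRiemannianMetric.continuous_edist hg).comp (Continuous.prodMk_right o))
      fun x ↦ PseudoRiemannianMetric.edist_ne_top hg o x
  obtain ⟨o⟩ := ‹Nonempty M›
  have h2 : ∃ o : M, Integrable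
      (fun x ↦ (g.edist hg o x).toReal ^ 2 * (Real.exp (φ x) * Real.exp (-V x))) μ := by
    refine ⟨o, ?_⟩
    simp_rw [hφV]
    exact hInt (((hdist o).pow 2).mul (continuous_const.mul hehf))
  have hFisher : Integrable (fun x ↦ g.gradSq φ x * (Real.exp (φ x) * Real.exp (-V x))) μ := by
    simp_rw [hφV, hgradφ]
    exact hInt (hgradc.mul (continuous_const.mul hehf))
  -- the inequality with `K = ½`
  have hmain : ∫ x, φ x * (Real.exp (φ x) * Real.exp (-V x)) ∂μ ≤
      1 / (2 * (1 / 2 : ℝ)) * ∫ x, g.gradSq φ x * (Real.exp (φ x) * Real.exp (-V x)) ∂μ :=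
    BakryEmeryComplete.bakryEmeryLogSobolev_proof n M g V (1 / 2) hg hcpl hVs (by norm_num) hRic
      hmass φ hφs hφmass h2 hFisher
  have hl : ∫ x, φ x * (Real.exp (φ x) * Real.exp (-V x)) ∂μ = B⁻¹ * A + c := by
    have h1 : ∀ x, φ x * (Real.exp (φ x) * Real.exp (-V x)) =
        B⁻¹ * (h x * Real.exp (h x - f x)) + c * B⁻¹ * Real.exp (h x - f x) := fun x ↦ by
      rw [hφV]
      simp only [hφ]
      ring
    have hAint : Integrable (fun x ↦ h x * Real.exp (h x - f x)) μ := hInt (hh.continuous.mul hehf)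
    have hBint : Integrable (fun x ↦ Real.exp (h x - f x)) μ := hInt hehf
    simp_rw [h1]
    rw [integral_add (hAint.const_mul _) (hBint.const_mul _), integral_const_mul, integral_const_mul,
      ← hA, ← hB, mul_assoc, inv_mul_cancel₀ hBne, mul_one]
  have hr : ∫ x, g.gradSq φ x * (Real.exp (φ x) * Real.exp (-V x)) ∂μ = B⁻¹ * G := by
    have h1 : ∀ x, g.gradSq φ x * (Real.exp (φ x) * Real.exp (-V x)) =
        B⁻¹ * (g.gradSq h x * Real.exp (h x - f x)) := fun x ↦ by
      rw [hφV, hgradφ]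
      ring
    simp_rw [h1]
    rw [integral_const_mul, ← hG]
  rw [hl, hr, show (1 : ℝ) / (2 * (1 / 2)) = 1 by norm_num, one_mul] at hmain
  -- multiply through by `B > 0`
  have key : A + B * c ≤ G := by
    have h3 := mul_le_mul_of_nonneg_left hmain hBpos.le
    rwa [mul_add, ← mul_assoc, ← mul_assoc, mul_inv_cancel₀ hBne, one_mul, one_mul] at h3
  rw [Real.log_div hBne hZpos.ne']
  rw [hc] at key
  linarith

end Connected

/-- **Registered helper `helper_shrinkerLogSobolev` of line `cgy-variance-pivot`** — the log-Sobolev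
inequality of the closed shrinker on a homotopy 4-sphere: for `M ≃ₕ S⁴` closed, `g` Riemannian
(Levi-Civita), `f` smooth with `Ric + Hess f = g/2`, and every smooth `h`,
`∫ h e^{h−f} dV − (∫ e^{h−f} dV) log (∫ e^{h−f} dV / ∫ e^{−f} dV) ≤ ∫ |∇h|² e^{h−f} dV` (Bakry–Émery with
`K = ½` for the probability measure `e^{-f}dV/Z`; `M` is simply connected, hence connected, and
`shrinkerLogSobolev_of_connectedSpace` applies). [cite: CarrilloNi2009, Thm. 3.1 (p. 7)]
[cite: BakryGentilLedoux2014, Prop. 5.7.1 (p. 268)] -/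
theorem helper_shrinkerLogSobolev :
    ∀ (M : Type) [TopologicalSpace M] [T2Space M] [SecondCountableTopology M]
      [ChartedSpace (EuclideanSpace ℝ (Fin 4)) M] [IsManifold (𝓡 4) ∞ M] [CompactSpace M]
      [T3Space M] [MeasurableSpace M] [BorelSpace M],
      M ≃ₕ Metric.sphere (0 : EuclideanSpace ℝ (Fin 5)) 1 →
    ∀ (g : Literature.Geometry.Lorentzian.PseudoRiemannianMetric (𝓡 4) ∞ (EuclideanSpace ℝ (Fin 4))
        (TangentSpace (𝓡 4) : M → Type _)) [g.HasLeviCivita] (f : M → ℝ) (hg : g.IsRiemannian),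
      ContMDiff (𝓡 4) 𝓘(ℝ, ℝ) ∞ f →
      (∀ (x : M) (X Y : TangentSpace (𝓡 4) x),
        g.ricci x X Y + g.hessian f x X Y = (1 / 2 : ℝ) * g.val x X Y) →
      ∀ (h : M → ℝ), ContMDiff (𝓡 4) 𝓘(ℝ, ℝ) ∞ h →
      ∫ x, h x * Real.exp (h x - f x)
          ∂(Literature.Geometry.Lorentzian.riemannianMeasure (g.toContMDiffRiemannianMetric hg)) -
        (∫ x, Real.exp (h x - f x)
          ∂(Literature.Geometry.Lorentzian.riemannianMeasure (g.toContMDiffRiemannianMetric hg))) *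
          Real.log ((∫ x, Real.exp (h x - f x)
              ∂(Literature.Geometry.Lorentzian.riemannianMeasure (g.toContMDiffRiemannianMetric hg))) /
            (∫ x, Real.exp (-f x)
              ∂(Literature.Geometry.Lorentzian.riemannianMeasure (g.toContMDiffRiemannianMetric hg)))) ≤
      ∫ x, g.gradSq h x * Real.exp (h x - f x)
          ∂(Literature.Geometry.Lorentzian.riemannianMeasure (g.toContMDiffRiemannianMetric hg)) := by
  intro M _ _ _ _ _ _ _ _ _ e g _ f hg hf hsol h hh
  -- `M ≃ₕ S⁴` is simply connected, hence connected
  haveI : SimplyConnectedSpace (Metric.sphere (0 : EuclideanSpace ℝ (Fin (4 + 1))) 1) :=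
    Literature.AlgebraicTopology.FundamentalGroup.simplyConnectedSpace_euclideanSphere 4 (by norm_num)
  haveI : SimplyConnectedSpace M := e.simplyConnectedSpace_iff.2 inferInstance
  exact shrinkerLogSobolev_of_connectedSpace hg hf hsol hh

end Summit.SmoothPoincare4.SmoothPoincare4.Theorems

end
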